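import Summits.QuantumFields.YangMills.Theorems.BalabanUVNodesN12NearFlatDelta2LetterComponent
import Literature.MathematicalPhysics.QuantumFieldTheory.Balaban1983to89.Node00.MultiScaleFibreChartB
import Literature.MathematicalPhysics.QuantumFieldTheory.Balaban1983to89.Node00.MultiScaleFibreChartCurvatureUniformB
import Literature.MathematicalPhysics.QuantumFieldTheory.Balaban1983to89.Node00.MultiScaleFibreChartLagrangeB
import Summits.QuantumFields.YangMills.Theorems.BalabanUVNodesN12NearFlatDelta2LetterB
import HarnessLib

/-!
# DAG node N12 [B15] — THE LETTER (δ₂) PER COMPONENT, WITH NEAR-FLATNESS ON THAT COMPONENT's TOWER ONLY: — **BOND-DATUM EDITION** (`…N12NearFlatDelta2LetterComponentB`, USED DECLARATIONS ONLY)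

The print-datum ([Balaban1984PropagatorsII] (2.3)) (γ) twin of `Summits/…/Theorems/BalabanUVNodesN12NearFlatDelta2LetterComponent.lean`: the declarations of the parent whose STATEMENT reads the determining datum
(`exists_delta2_letter_component`, `msChart_apply_eq_of_eqOn_feeds_of_fibre`) and which N12's junction of record v14ᴸ uses (dag-n12-c g35 probe-2 census `UsedConstsN12RoadTyped2`, THEOREMS block), re-typed over a
BOND-LEVEL datum `𝔅 : BDetSet` (F0a `B15DeterminingSetsB`) and dag-n12-c's bond-datum chart `Node00.msChartB` (✓p774329; `msChart 𝐁 = msChartB (bondsDet 𝐁)` by `rfl`).  GENERATOR twin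
(this seat's `work/g32/gen_thm.py`, block-extracted from the parent's tree bytes): namespace `…N12NearFlatDelta2LetterComponentB`, SAME short names, `DetSet ↦ BDetSet`, `AgreeOn 𝐁 ↦ AgreeOnB 𝔅`,
`IsMinimizer ↦ IsMinimizerB`, `bondsOf (𝐁 j) ↦ 𝔅 j`, `msChart ∕ constrCard ∕ constrEnum ∕ ConstrSet ↦ …B`, NODE 00 chart lemmas `…msChart… ↦ …msChartB…`; proofs VERBATIM; the parent's
datum-free declarations REUSED BY NAME (`open`), never copied (private plumbing excepted, №366 R2).  The parent's (b) statements are the instances `𝔅 := bondsDet 𝐁`.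

Cell `pub-ymgap` (HUMAN RULINGS D-0062 ∕ D-0149), seat `pub-ymgap-dag-n12-d` g32 (R134 N12 [B15] s2; the (ii) Theorems-side re-key of N12's road at print's [II] (2.3) datum — director-ym №338 ∕
№343 (E1)(iii-b), FLAG №16 ∕ ruling (α); dag-n12-c DESIGN memo a793b2ebc0b803bf (ii); `N12-ROAD-TWIN-ORDER-2026-08-30.md`).  Count-neutral helper of K1⁹ `stmt-QuantumFields-27364`,
`--kind proof --supports … --as helper`.  THEOREMS ONLY (0 `def`, 0 `instance`, 0 `sorry`).

HONEST FRAMING (director-ym №338 (5)).  PURELY ADDITIVE: the parent stays landed and true on its own text; nothing in it is edited; no displayed premise of any consumer is deleted or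
weakened; every hypothesis of the parent stays a hypothesis.  Nothing of Bałaban's analysis asserted; N12 NOT discharged; K0⁷ ∕ K1⁹ NOT closed; counts unmoved (typed 28∕28 · discharged
8∕27, A 8∕28; K 1∕4); one finite 𝕋⁴ programme at fixed ε — R4 closes the conditional rung `BalabanLadder.UV` only; NOT the Yang–Mills mass gap (Clay); nothing continuum ∕ ℝ⁴ ∕ OS.

PARENT's DOCSTRING (the mathematics and the citations; read the site-level `𝐁` as the bond datum `𝔅`):
# DAG node N12 [B15] — THE LETTER (δ₂) PER COMPONENT, WITH NEAR-FLATNESS ON THAT COMPONENT's TOWER ONLY: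
# `‖(DΨ_{𝐁,W,U₀}(0)w)_i − (DΦ♭(0)w)_i‖ ≤ C·δ·p(w)` as soon as `‖↑U₀_b − 1‖ ≤ δ` on `feeds j_i c_i` — the gauge-dependent comparison row of the chart of record localised to ONE tower
# (dag-n12-c's LOCATED-GEOM v3 (X2) ∕ DIRECT road step (ii): «module E on the WINDOW TOWERS ONLY»)

Cell `pub-ymgap` (HUMAN RULINGS D-0062 ∕ D-0149), width seat `pub-ymgap-dag-n12-w4` g5 (the (δ₂) lineage p618836 ∕ p620953 of this seat).  Key K1⁹ `stmt-QuantumFields-27364`,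
`--kind proof --supports … --as helper`; count-neutral; THEOREMS ONLY (0 `def`, 0 `sorry`, 0 `instance`).  WHY: the local edition `exists_delta2_letter_local` (p620953) asks near-flatness on
`inputs 𝐁` — every tower of every constrained bond, ≈ all fine bonds of `Ω₁(Z)` at the record, which a ring-shaped `Ω₁(Z)` with holonomy forbids (LOCATED-GEOM v3, n12-c's
`B15Prop1HolonomyObstruction`).  The `i`-th component of the chart reads `U` only on the tower `feeds j_i c_i` ([III] (2.11), this seat's `Node00.MultiScaleFibreChartLocalityComponent`), so the
`i`-th row of (δ₂) needs near-flatness THERE only: flatten `U₀` off the tower (`Node00.exists_nearFlat_eqOn`), re-label the fibre by the proxy's own averages (the `(j_i, c_i)` average is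
unchanged by `iter_local`), apply the global letter p618836 `exists_delta2_letter` to the proxy, and read the `i`-th component.  CONSUMED BY NAME: `exists_delta2_letter`, `exists_guard_of_nearFlat`
(p618836 ∕ p620953), `Node00.exists_nearFlat_eqOn` (p620013), `Node00.exists_uniform_chartCurvature_sq_bound` (p615328: the `SmallBelow` guard of a near-flat field), `Node00.differentiableAt_msChart`
(p610492), n07-w2's `Node00.msChart_apply` ∕ `relAvg`, `B14.Eq216Concrete.iter_local`.

THE PRINT.  [Balaban1989LargeFieldII] p. 357 («U₀ = exp(iA₀) with A₀ small on the domain Z»), (1.12)–(1.13) p. 359; [Balaban1988Convergent] (2.11) p. 256 (locality of `M^j`: the average at a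
`j`-bond depends on the field on its tower only); [Balaban1985Variational] (47) p. 285, (81)–(83) p. 290.

CONTENTS.  §1 `fderiv_apply_eq_fderiv_component` (the `i`-th component of `DΨ(0)w` is the derivative of the `i`-th component), ★ `msChart_apply_eq_of_eqOn_feeds_of_fibre`
(`Ψ_{𝐁,W,U₀}(X)_i = Ψ_{𝐁,M˙U′,U′}(X)_i` for ALL `X` when `U′ = U₀` on the tower and `W` is `U₀`'s fibre label).  §2 ★★★ `exists_delta2_letter_component` — ONE `C ≥ 0`, `ρ > 0` per height:
for every `𝐁` with no member above `k ≤ m + K`, every `W`, `U₀` in the fibre with `Ψ_{𝐁,W,U₀}` differentiable at `0`, every index `i` and `0 ≤ δ < ρ` with `‖↑U₀_b − 1‖ ≤ δ` on `feeds j_i c_i`: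
`‖(DΨ_{𝐁,W,U₀}(0)w)_i − (DΦ♭(0)w)_i‖ ≤ C·δ·p(w)` for every `w`; `exists_delta2_letter_component_Bj` (at `𝐁_k(Z)`).

HONEST FRAMING.  Composition BY NAME over landed kernel theorems; per-height existence constants (NOT print's volume-uniform `O(1)`); nothing of Bałaban's asserted; N12 NOT discharged;
K1⁹ NOT closed; count-neutral (typed 28∕28 · discharged 5∕27 unmoved); one finite 𝕋⁴ programme at fixed ε — R4 closes the conditional rung `BalabanLadder.UV` only; the YM mass gap (Clay) is
NOT proved by any of this.
-/

noncomputable section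

open scoped BigOperators Matrix.Norms.L2Operator Topology
open Filter Finset

namespace Summit.QuantumFields.YangMills.BalabanUVNodes.N12NearFlatDelta2LetterComponentB

open Literature.MathematicalPhysics.QuantumFieldTheory.Balaban1983to89.B15DeterminingSetsB

open Literature.MathematicalPhysics.QuantumFieldTheory.Balaban1983to89
open T4Continuum (T4Family)
open BlockAveragingEMLLinearised (linAvg)
open T4AdjointCovarianceUnitary (lieSU)
open B15DeterminingSets
open B14.Eq213DetSet (Bj)
open B14.Eq216Concrete (feeds inputs iter_local)
open Node00
open Summit.QuantumFields.YangMills.BalabanUVNodes.N12NearFlatDelta2Letter (exists_guard_of_nearFlat)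
open Summit.QuantumFields.YangMills.BalabanUVNodes.N12NearFlatDelta2LetterB (exists_delta2_letter)
open Summit.QuantumFields.YangMills.BalabanUVNodes.N12NearFlatDelta2LetterComponent (fderiv_apply_eq_fderiv_component)

section
variable {F : T4Family} {N : ℕ} [NeZero N] {K k : ℕ}

/-- ★ **THE `i`-TH COMPONENT READS `U` ON ITS TOWER AND `W` AT ITS OWN INDEX**: if `U′ = U₀` on `feeds j_i c_i` and `W` is `U₀`'s fibre label on `𝐁` (`M_𝐁(U₀) = W`), then for EVERY `X`
`Ψ_{𝐁,W,U₀}(X)_i = Ψ_{𝐁,M˙U′,U′}(X)_i` — the averages of `U₀·e^X` and `U′·e^X` at `(j_i, c_i)` agree by locality ([III] (2.11), `iter_local`), and so do the labels `W_{j_i}(c_i) = M˙(U₀)_{j_i}(c_i) =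
M˙(U′)_{j_i}(c_i)`. [cite: Balaban1988Convergent, (2.11) p.256, (2.10) p.256; Balaban1985Variational, (47) p.285] -/
theorem msChart_apply_eq_of_eqOn_feeds_of_fibre (hk : k ≤ (F.P K).m + (F.P K).K) {𝔅 : BDetSet (F.P K)} {W : MSField (F.P K) (SU N)}
    {U₀ U' : GaugeField (F.P K) 0 (SU N)} (hU : AgreeOnB 𝔅 (avgFamily (avOfRecord F N K) U₀) W) (i : Fin (constrCardB 𝔅 k))
    (hin : ∀ b ∈ feeds (((constrEnumB 𝔅 k).symm i).1 : ℕ) ((constrEnumB 𝔅 k).symm i).2.1, U' b = U₀ b) (X : PBond (F.P K) 0 → lieSU (Fin N)) :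
    msChartB F N K k 𝔅 W U₀ X i = msChartB F N K k 𝔅 (avgFamily (avOfRecord F N K) U') U' X i := by
  have hj : (((constrEnumB 𝔅 k).symm i).1 : ℕ) ≤ (F.P K).m + (F.P K).K := (Nat.le_of_lt_succ ((constrEnumB 𝔅 k).symm i).1.2).trans hk
  have hW : W (((constrEnumB 𝔅 k).symm i).1 : ℕ) ((constrEnumB 𝔅 k).symm i).2.1
      = avgFamily (avOfRecord F N K) U' (((constrEnumB 𝔅 k).symm i).1 : ℕ) ((constrEnumB 𝔅 k).symm i).2.1 := by
    rw [← hU _ _ ((constrEnumB 𝔅 k).symm i).2.2]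
    exact iter_local (avOfRecord F N K) _ hj _ _ _ fun b hb => (hin b hb).symm
  have hav : avgFamily (avOfRecord F N K) (expChart U₀ X) (((constrEnumB 𝔅 k).symm i).1 : ℕ) ((constrEnumB 𝔅 k).symm i).2.1
      = avgFamily (avOfRecord F N K) (expChart U' X) (((constrEnumB 𝔅 k).symm i).1 : ℕ) ((constrEnumB 𝔅 k).symm i).2.1 :=
    iter_local (avOfRecord F N K) _ hj _ _ _ fun b hb => by unfold expChart; rw [hin b hb]
  rw [msChartB_apply, msChartB_apply, relAvg, relAvg, hW, hav]

end

section
variable {F : T4Family} {N : ℕ} [NeZero N] {K k : ℕ}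

/-- ★★★ **THE LETTER (δ₂), COMPONENT EDITION** — ONE `C ≥ 0` and ONE `ρ > 0` per height: for every determining set `𝐁` with no member above `k ≤ m + K`, every datum `W`, every `U₀` IN THE
FIBRE with `Ψ_{𝐁,W,U₀}` differentiable at `0`, every constrained index `i` and every `0 ≤ δ < ρ` with `‖↑U₀_b − 1‖ ≤ δ` ON THE TOWER `feeds j_i c_i` ONLY:
`‖(DΨ_{𝐁,W,U₀}(0)w)_i − (DΨ_{𝐁,M˙1,1}(0)w)_i‖ ≤ C·δ·p(w)` for every `w`.  (p618836's global letter at the proxy `U′ := U₀` on the tower, `1` off it — globally `δ`-near-flat, guarded by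
`exists_guard_of_nearFlat` ∕ the `SmallBelow` radius of `exists_uniform_chartCurvatureB_sq_bound`, in its own fibre `M˙U′` — and §1's component identity.)  No hypothesis on `U₀` off the tower.
[cite: Balaban1989LargeFieldII, p.357, (1.12)–(1.13) p.359; Balaban1988Convergent, (2.11)–(2.13) pp.256–257; Balaban1985Variational, (47) p.285, (81)–(83) p.290] -/
theorem exists_delta2_letter_component (k : ℕ)
    (Q : (i : ℕ) → (PBond (F.P K) 0 → Matrix (Fin N) (Fin N) ℂ) → PBond (F.P K) i → Matrix (Fin N) (Fin N) ℂ)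
    (hQ0 : ∀ Y, Q 0 Y = Y) (hQs : ∀ (i : ℕ) (Y : PBond (F.P K) 0 → Matrix (Fin N) (Fin N) ℂ) (c : PBond (F.P K) (i + 1)), Q (i + 1) Y c = linAvg (Q i Y) c)
    (p : Seminorm ℝ (PBond (F.P K) 0 → lieSU (Fin N)))
    (hp : ∀ Y : PBond (F.P K) 0 → lieSU (Fin N), ∑ b, ‖(Y b : Matrix (Fin N) (Fin N) ℂ)‖ ^ 2 ≤ p Y ^ 2) :
    ∃ C ρ : ℝ, 0 ≤ C ∧ 0 < ρ ∧
      ∀ (𝔅 : BDetSet (F.P K)) (W : MSField (F.P K) (SU N)) (U₀ : GaugeField (F.P K) 0 (SU N)),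
        (∀ j, k < j → 𝔅 j = ∅) → k ≤ (F.P K).m + (F.P K).K →
        AgreeOnB 𝔅 (avgFamily (avOfRecord F N K) U₀) W → DifferentiableAt ℝ (msChartB F N K k 𝔅 W U₀) 0 →
        ∀ (i : Fin (constrCardB 𝔅 k)) ⦃δ : ℝ⦄, 0 ≤ δ → δ < ρ →
        (∀ b ∈ feeds (((constrEnumB 𝔅 k).symm i).1 : ℕ) ((constrEnumB 𝔅 k).symm i).2.1, ‖((U₀ b : SU N) : Matrix (Fin N) (Fin N) ℂ) - 1‖ ≤ δ) →
        ∀ w : PBond (F.P K) 0 → lieSU (Fin N),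
          ‖fderiv ℝ (msChartB F N K k 𝔅 W U₀) 0 w i
              - fderiv ℝ (msChartB F N K k 𝔅 (avgFamily (avOfRecord F N K) (1 : GaugeField (F.P K) 0 (SU N))) (1 : GaugeField (F.P K) 0 (SU N))) 0 w i‖
            ≤ C * δ * p w := by
  obtain ⟨C, ρ₁, hC, hρ₁, h⟩ := exists_delta2_letter (F := F) (N := N) (K := K) k Q hQ0 hQs p hp
  obtain ⟨t₀, ρg, ht₀, hst, hρg, hguard⟩ := exists_guard_of_nearFlat (F := F) (N := N) K k
  obtain ⟨_, ρ'', _, hρ'', hsb, _⟩ := exists_uniform_chartCurvatureB_sq_bound (F := F) (N := N) (K := K) k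
  refine ⟨C, min ρ₁ (min ρg ρ''), hC, lt_min hρ₁ (lt_min hρg hρ''), fun 𝔅 W U₀ _ hk hU hΨ i δ hδ0 hδρ hloc w => ?_⟩
  -- the proxy: `U₀` on the tower, `1` elsewhere
  obtain ⟨U', hin, hflat⟩ := Node00.exists_nearFlat_eqOn U₀ _ hδ0 hloc
  have hρ1 : δ < ρ₁ := lt_of_lt_of_le hδρ (min_le_left _ _)
  have hρ2 : δ ≤ ρg := (le_of_lt hδρ).trans ((min_le_right _ _).trans (min_le_left _ _))
  have hρ3 : δ ≤ ρ'' := (le_of_lt hδρ).trans ((min_le_right _ _).trans (min_le_right _ _))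
  have hg : ∀ i', i' < k → PlaqSmall t₀ (Averaging.iter (avOfRecord F N K) i' U') := fun i' hi' => hguard U' (hflat.trans hρ2) i' hi'.le
  have hlt : ‖coeField U' - 1‖ < ρ₁ := lt_of_le_of_lt hflat hρ1
  have hAgr : AgreeOnB 𝔅 (avgFamily (avOfRecord F N K) U') (avgFamily (avOfRecord F N K) U') := fun _ _ _ => rfl
  -- the global letter at the proxy in its own fibre
  have key := h ht₀ hst U' 𝔅 (avgFamily (avOfRecord F N K) U') hg hlt hAgr w
  have keyi : ‖fderiv ℝ (msChartB F N K k 𝔅 (avgFamily (avOfRecord F N K) U') U') 0 w i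
      - fderiv ℝ (msChartB F N K k 𝔅 (avgFamily (avOfRecord F N K) (1 : GaugeField (F.P K) 0 (SU N))) (1 : GaugeField (F.P K) 0 (SU N))) 0 w i‖ ≤ C * δ * p w := by
    rw [← Pi.sub_apply]
    exact (norm_le_pi_norm _ i).trans (key.trans (mul_le_mul_of_nonneg_right (mul_le_mul_of_nonneg_left hflat hC) (apply_nonneg p w)))
  -- the component identity `(DΨ_{W,U₀}(0)w)_i = (DΨ_{M˙U′,U′}(0)w)_i`
  have hΨ' : DifferentiableAt ℝ (msChartB F N K k 𝔅 (avgFamily (avOfRecord F N K) U') U') 0 := differentiableAt_msChartB hAgr (hsb U' (hflat.trans hρ3))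
  have hfun : (fun X => msChartB F N K k 𝔅 W U₀ X i) = fun X => msChartB F N K k 𝔅 (avgFamily (avOfRecord F N K) U') U' X i :=
    funext fun X => msChart_apply_eq_of_eqOn_feeds_of_fibre hk hU i hin X
  have hcomp : fderiv ℝ (msChartB F N K k 𝔅 W U₀) 0 w i = fderiv ℝ (msChartB F N K k 𝔅 (avgFamily (avOfRecord F N K) U') U') 0 w i := by
    rw [fderiv_apply_eq_fderiv_component hΨ, fderiv_apply_eq_fderiv_component hΨ', hfun]
  rw [hcomp]
  exact keyi

end

end Summit.QuantumFields.YangMills.BalabanUVNodes.N12NearFlatDelta2LetterComponentB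

end
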